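import Mathlib.NumberTheory.Padics.Complex
import Mathlib.Topology.Instances.Matrix
import Mathlib.Topology.Algebra.MvPolynomial
import Mathlib.LinearAlgebra.Matrix.Charpoly.Univ
import Summits.Langlands.Langlands.Theorems.PhantomRMYoshidaResiduallyYoshidaLiftingCrossRegularDefs
import Literature.NumberTheory.GaloisRepresentations.FrobeniusDensity
import Literature.NumberTheory.Automorphic.ChebotarevArtinRepHolds
import Literature.NumberTheory.GaloisRepresentations.ResidualPairIntegrality
import HarnessLib

/-!
# A Frobenius-a.e. catalogue of members is a trace catalogue (Chebotarev + continuity)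

Sub-goal `stub_traceCatalogue_of_frobCatalogue` of stub `stub_traceCatalogue` (S5c) of line
`cross-regular-annihilator-primes` for the crux
`Summit.Langlands.Langlands.Theses.PhantomRMYoshida.ResiduallyYoshidaLifting` (stmt-Langlands-13639),
over the landed currency `Theorems/PhantomRMYoshidaResiduallyYoshidaLiftingCrossRegularDefs.lean`
(`Member`, `Sh` of namespace
`Summit.Langlands.Langlands.Cruxes.ResiduallyYoshidaLifting.CrossRegularAnnihilatorPrimes`).

S5c asks that the members `(π, r)` of level `K(𝔫₁)` and infinity type `T₁` fall into finitely many
classes for POINTWISE equality of characteristic polynomials on `Γ_ℚ`, each class represented by a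
member.  On paper this is Harish-Chandra finiteness (finitely many such `π`; the tree's named fact
`Literature.NumberTheory.Automorphic.harishChandra_finiteness_gl`, unproved) followed by the upgrade
"two continuous `r, r' : Γ_ℚ → GL_n(ℚ̄_p)`, unramified almost everywhere, with the same Frobenius
polynomials at almost all places have `det(X - r(g)) = det(X - r'(g))` for EVERY `g ∈ Γ_ℚ`".  This
file proves the upgrade (`charpoly_eq_of_hasFrobCharpolyAt_iff_eventually`) and hence the provable
half of S5c: a finite catalogue of members up to Frobenius-a.e. equivalence is already a catalogue up
to pointwise trace equivalence (`stub_traceCatalogue_of_frobCatalogue`).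

Proof of the upgrade.  The coincidence set `E = {g | det(X - r(g)) = det(X - r'(g))}` is closed: it
is the intersection over `j` of the coincidence sets of the `j`-th coefficients, which are continuous
in `g` (polynomials in the matrix entries, Mathlib `Matrix.charpoly.univ`; `ℚ̄_p` is Hausdorff).  It
contains every arithmetic Frobenius `g` at a place `v` outside the finite exceptional set `S` (where
the equivalence fails or `r` or `r'` is ramified): there `det(X - r(g))` is the Frobenius polynomial
of `r` at `v` (`FramedGaloisRep.IsUnramifiedAt.hasFrobCharpolyAt_charpoly`), hence of `r'`, hence
equals `det(X - r'(g))` (`FramedGaloisRep.HasFrobCharpolyAt.unique`).  These Frobenii are dense in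
`Γ_ℚ` (`absoluteGaloisGroup.frobenius_dense`, from the proved Chebotarev theorem
`Automorphic.chebotarev_artinRep_holds`), so `E = Γ_ℚ`.

## References

* J.-P. Serre, *Abelian ℓ-adic representations and elliptic curves* (1968), Ch. I §2.2 Cor. 2 (a)
  (Frobenii are dense), §2.3. [SerreAbelianLadic1968]
* A. Borel, H. Jacquet, *Automorphic forms and automorphic representations*, Proc. Sympos. Pure
  Math. 33 (1979), Part 1, 4.3 (i), 4.6. [BorelJacquet1979]
* J. Thorne, *Automorphy of some residually dihedral Galois representations*, Math. Ann. 364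
  (2016), Cor. 4.15. [Thorne2016]
-/

noncomputable section

-- `Summit.Langlands.Langlands.…` (summit = sub-problem name, D-0017 layout) trips `dupNamespace` on every decl.
set_option linter.dupNamespace false

open Field IsDedekindDomain Filter Topology
open scoped NumberField Valued

namespace Summit.Langlands.Langlands.Cruxes.ResiduallyYoshidaLifting.CrossRegularAnnihilatorPrimes

open Literature.NumberTheory.GaloisRepresentations

section Helpers

/-- The coefficients of the characteristic polynomial depend continuously on the matrix (they are
polynomials in the entries: Mathlib `Matrix.charpoly.univ`). [folklore] -/
private theorem continuous_charpoly_coeff {X A : Type*} [TopologicalSpace X] [CommRing A]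
    [TopologicalSpace A] [IsTopologicalRing A] {n : Type*} [Fintype n] [DecidableEq n]
    {f : X → Matrix n n A} (hf : Continuous f) (i : ℕ) :
    Continuous fun x => (f x).charpoly.coeff i := by
  -- adapted from `Theorems/PhantomRMYoshidaResiduallyYoshidaLiftingCrossRegularSupply.lean`,
  -- `continuous_charpoly_coeff`
  have h : (fun x => (f x).charpoly.coeff i) = fun x =>
      MvPolynomial.eval (fun ij : n × n => f x ij.1 ij.2) ((Matrix.charpoly.univ A n).coeff i) := by
    funext x
    exact (Matrix.charpoly.univ_coeff_eval₂Hom n (RingHom.id A) (fun ij : n × n => f x ij.1 ij.2) i).symm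
  rw [h]
  exact (MvPolynomial.continuous_eval _).comp (continuous_pi fun ij => hf.matrix_elem ij.1 ij.2)

/-- The coincidence set of the characteristic polynomials of two continuous matrix-valued maps into
a Hausdorff topological ring is closed (coefficientwise `isClosed_eq`). [folklore] -/
private theorem isClosed_setOf_charpoly_eq {X A : Type*} [TopologicalSpace X] [CommRing A]
    [TopologicalSpace A] [IsTopologicalRing A] [T2Space A] {n : Type*} [Fintype n] [DecidableEq n]
    {f g : X → Matrix n n A} (hf : Continuous f) (hg : Continuous g) :
    IsClosed {x | (f x).charpoly = (g x).charpoly} := by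
  have h : {x | (f x).charpoly = (g x).charpoly} =
      ⋂ i : ℕ, {x | (f x).charpoly.coeff i = (g x).charpoly.coeff i} := by
    ext x
    simp only [Set.mem_setOf_eq, Set.mem_iInter, Polynomial.ext_iff]
  rw [h]
  exact isClosed_iInter fun i =>
    isClosed_eq (continuous_charpoly_coeff hf i) (continuous_charpoly_coeff hg i)

/-- An eventually-cofinite property holds outside a finite set. [folklore] -/
private theorem exists_finite_forall_of_eventually_cofinite {α : Type*} {q : α → Prop}
    (h : ∀ᶠ x in cofinite, q x) : ∃ S : Set α, S.Finite ∧ ∀ x ∉ S, q x :=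
  -- adapted from `Theorems/PhantomRMYoshidaResiduallyYoshidaLiftingResidualCharpoly.lean`
  ⟨{x | ¬q x}, Filter.eventually_cofinite.1 h, fun _ hx => not_not.1 hx⟩

end Helpers

/-- **Frobenius-a.e. equivalence is pointwise trace equivalence (Chebotarev + continuity).**  Let
`r, r' : Γ_ℚ → GL_n(ℚ̄_p)` be continuous and unramified at almost all places, and suppose that at
almost all places `v` they have the same Frobenius polynomials
(`r.HasFrobCharpolyAt v P ↔ r'.HasFrobCharpolyAt v P` for all `P`).  Then
`det(X - r(g)) = det(X - r'(g))` for EVERY `g ∈ Γ_ℚ`.  Proof: the coincidence set is closed (the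
coefficients of `det(X - r(g))` are continuous in `g`, `Matrix.charpoly.univ`); it contains every
arithmetic Frobenius at a place outside the finite exceptional set
(`IsUnramifiedAt.hasFrobCharpolyAt_charpoly`, `HasFrobCharpolyAt.unique`), and these Frobenii are
dense (`absoluteGaloisGroup.frobenius_dense chebotarev_artinRep_holds`).
[cite: SerreAbelianLadic1968, Ch. I §2.2 Cor. 2 (a) and §2.3] -/
theorem charpoly_eq_of_hasFrobCharpolyAt_iff_eventually {p : ℕ} [Fact p.Prime] {n : ℕ}
    {r r' : FramedGaloisRep ℚ (PadicAlgCl p) n}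
    (hr : ∀ᶠ v : HeightOneSpectrum (𝓞 ℚ) in cofinite, r.IsUnramifiedAt v)
    (hr' : ∀ᶠ v : HeightOneSpectrum (𝓞 ℚ) in cofinite, r'.IsUnramifiedAt v)
    (h : ∀ᶠ v : HeightOneSpectrum (𝓞 ℚ) in cofinite, ∀ P : Polynomial (PadicAlgCl p),
      r.HasFrobCharpolyAt v P ↔ r'.HasFrobCharpolyAt v P) :
    ∀ g, (r g).val.charpoly = (r' g).val.charpoly := by
  -- the finite exceptional set `S` and the density of the Frobenii outside `S` (Chebotarev)
  obtain ⟨S, hS, hSc⟩ := exists_finite_forall_of_eventually_cofinite (hr.and (hr'.and h))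
  have hD := absoluteGaloisGroup.frobenius_dense
    Literature.NumberTheory.Automorphic.chebotarev_artinRep_holds ℚ S hS
  -- the coincidence set is closed
  have hE : IsClosed {g : absoluteGaloisGroup ℚ | (r g).val.charpoly = (r' g).val.charpoly} :=
    isClosed_setOf_charpoly_eq (Units.continuous_val.comp (map_continuous r))
      (Units.continuous_val.comp (map_continuous r'))
  -- so it suffices to check the identity at the Frobenii outside `S`
  intro g
  refine hE.closure_subset_iff.2 (fun x hx => ?_) (hD g)
  obtain ⟨v, hv, 𝔓, h𝔓, hx⟩ := hx
  obtain ⟨hrv, hr'v, hiff⟩ := hSc v hv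
  exact ((hiff _).1 (hrv.hasFrobCharpolyAt_charpoly h𝔓 hx)).unique
    (hr'v.hasFrobCharpolyAt_charpoly h𝔓 hx)

/-- **S5c, provable half (a Frobenius-a.e. catalogue is a trace catalogue).**  If the members
`(π, r)` of level `K(𝔫₁)` and infinity type `T₁`
(`Summit.Langlands.Langlands.Cruxes.ResiduallyYoshidaLifting.CrossRegularAnnihilatorPrimes.Member`)
fall into finitely many classes for "same Frobenius polynomials at almost all places", each
represented by a member `(πc j, rc j)`, then the same catalogue represents them up to POINTWISE
equality of characteristic polynomials on `Γ_ℚ`: every member's `r` is unramified almost everywhere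
(third conjunct of the shape clause `Sh ⊆ Member`), so
`charpoly_eq_of_hasFrobCharpolyAt_iff_eventually` (Chebotarev density + continuity of the
coefficients) upgrades each Frobenius-a.e. equivalence.  S5c itself is this statement plus
Harish-Chandra finiteness (finitely many such `π`; tree named fact `harishChandra_finiteness_gl`).
[cite: SerreAbelianLadic1968, Ch. I §2.2 Cor. 2 (a) and §2.3] -/
theorem stub_traceCatalogue_of_frobCatalogue : ∀ (p : ℕ) [Fact p.Prime], p ≠ 2 → ∀ (k : Type) [Field k] [CharP k p] [IsAlgClosed k] [TopologicalSpace k] [DiscreteTopology k] (red : Valued.integer (PadicAlgCl p) →+* k) (σ σ' : Literature.NumberTheory.GaloisRepresentations.FramedGaloisRep ℚ k 2) (hcpt : Literature.NumberTheory.Automorphic.isCompact_glFiniteIntegralLevel 4 ℚ) (ι : PadicAlgCl p ≃+* ℂ) (𝔫₁ : Ideal (NumberField.RingOfIntegers ℚ)) (T₁ : Literature.NumberTheory.Automorphic.InfinityType ℚ 4), 𝔫₁ ≠ 0 → (∃ (s : ℕ) (πc : Fin s → Literature.NumberTheory.Automorphic.CuspidalAutomorphicRepData 4 ℚ hcpt)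 (rc : Fin s → Literature.NumberTheory.GaloisRepresentations.FramedGaloisRep ℚ (PadicAlgCl p) 4), (∀ j, Summit.Langlands.Langlands.Cruxes.ResiduallyYoshidaLifting.CrossRegularAnnihilatorPrimes.Member σ σ' red ι 𝔫₁ T₁ (πc j) (rc j)) ∧ ∀ (π : Literature.NumberTheory.Automorphic.CuspidalAutomorphicRepData 4 ℚ hcpt) (r : Literature.NumberTheory.GaloisRepresentations.FramedGaloisRep ℚ (PadicAlgCl p) 4), Summit.Langlands.Langlands.Cruxes.ResiduallyYoshidaLifting.CrossRegularAnnihilatorPrimes.Member σ σ' red ι 𝔫₁ T₁ π r → ∃ j, ∀ᶠ v : IsDedekindDomain.HeightOneSpectrum (NumberField.RingOfIntegers ℚ) in Filter.cofinite, ∀ P : Polynomial (PadicAlgCl p), r.HasFrobCharpolyAt v P ↔ (rc j).HasFrobCharpolyAt v P) → ∃ (s : ℕ) (πc : Fin s → Literature.NumberTheory.Automorphic.CuspidalAutomorphicRepData 4 ℚ hcpt) (rc : Fin s → Literature.NumberTheory.GaloisRepresentations.FramedGaloisRep ℚ (PadicAlgCl p) 4), (∀ j, Summit.Langlands.Langlands.Cruxes.ResiduallyYoshidaLifting.CrossRegularAnnihilatorPrimes.Member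 σ σ' red ι 𝔫₁ T₁ (πc j) (rc j)) ∧ ∀ (π : Literature.NumberTheory.Automorphic.CuspidalAutomorphicRepData 4 ℚ hcpt) (r : Literature.NumberTheory.GaloisRepresentations.FramedGaloisRep ℚ (PadicAlgCl p) 4), Summit.Langlands.Langlands.Cruxes.ResiduallyYoshidaLifting.CrossRegularAnnihilatorPrimes.Member σ σ' red ι 𝔫₁ T₁ π r → ∃ j, ∀ g, (r g).val.charpoly = (rc j g).val.charpoly := by
  intro p _ _ k _ _ _ _ _ red σ σ' hcpt ι 𝔫₁ T₁ _ hcat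
  obtain ⟨s, πc, rc, hmem, hcat⟩ := hcat
  refine ⟨s, πc, rc, hmem, fun π r hπr => ?_⟩
  obtain ⟨j, hj⟩ := hcat π r hπr
  -- `r` and `rc j` are unramified almost everywhere (third conjunct of `Sh`, fifth of `Member`)
  obtain ⟨-, -, -, -, ⟨-, -, hr⟩, -⟩ := hπr
  obtain ⟨-, -, -, -, ⟨-, -, hrc⟩, -⟩ := hmem j
  exact ⟨j, charpoly_eq_of_hasFrobCharpolyAt_iff_eventually (hr.mono fun v hv => hv.1)
    (hrc.mono fun v hv => hv.1) hj⟩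

end Summit.Langlands.Langlands.Cruxes.ResiduallyYoshidaLifting.CrossRegularAnnihilatorPrimes

end
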